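import Summits.RiemannHypothesis.RiemannHypothesis.Theorems.PfPersistenceCoefficientRigidityFiniteSites
import Literature.NumberTheory.LFunctions.WeilArchimedeanPositivityProofs
import HarnessLib

/-!
# Coefficient rigidity of window positivity, VI: the defect energy density is exactly `-2|λ|`
(pub-rhpf cand-7, gen 9; mechanism/rigidity campaign; no RH claims)

Sixth part of `PfPersistenceCoefficientRigidity`.  Parts I and III-b showed that the one-site
perturbation `W_{λ,x₀} = W + λ(δ_{x₀} + δ_{-x₀})`, `x₀ > 0`, `λ ≠ 0`, is never positive on the
test class.  This file QUANTIFIES the failure by the Rayleigh quotient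
`q_λ(g) = Re W_{λ,x₀}(g ⋆ g̃) / ‖g‖₂²` ("defect energy density").  ALL STATEMENTS ARE PROVED
(no `sorry`, no new axioms, RH only as an explicit hypothesis or inside a `by_cases`); no
sentence is DATA.

* `exists_siteQuadratic_re_le_ratio` — **(RH-free)** for every `ε > 0` some test function has
  `Re W_{λ,x₀}(g ⋆ g̃) ≤ (-2|λ| + ε)‖g‖₂²`, `‖g‖₂ > 0`.
* `siteQuadratic_re_ge_of_riemannHypothesis` — under RH, `Re W_{λ,x₀}(g ⋆ g̃) ≥ -2|λ|‖g‖₂²`.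
* `le_of_siteQuadratic_lower_bound` — **(RH-free)** any `B` with `B‖g‖₂² ≤ Re W_{λ,x₀}(g ⋆ g̃)`
  for all test `g` satisfies `B ≤ -2|λ|` (the constant `2` of the a-priori bound of part I is
  sharp).
* `riemannHypothesis_iff_siteQuadratic_bddBelow` — **dichotomy**: RH holds iff the defect energy
  density is bounded below (for one, equivalently every, `λ` and `x₀ > 0`); i.e. the density is
  `-2|λ|` if RH holds and `-∞` otherwise (`isGLB_defectEnergy_of_riemannHypothesis`).  For
  `λ = 0` this is Weil's criterion (imported); RH is NOT claimed.

Mechanism: the upper construction is the wave packet of part III-a with carrier `t₀` near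
`π/x₀` (`λ ≥ 0`) or `2π/x₀` (`λ < 0`) and off the ordinates, so that `λ cos(t₀x₀) ≈ -|λ|`, the
zero side is `O(R⁻²)·‖g‖₂⁻²… = o(‖g‖₂²)` and `(g ⋆ g̃)(±x₀) ≈ cos(t₀x₀)‖g‖₂²` (Lipschitz overlap,
part IV-b); under `¬RH` the sinking ground energy of part I does better than any constant.

References: E. Bombieri, Rend. Lincei (9) 11 (2000) 183–233, Thm. 1 (Weil's criterion);
A. Weil (1952).
-/

set_option linter.dupNamespace false

noncomputable section

open Complex Filter Set MeasureTheory
open scoped Real Topology ComplexConjugate NNReal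

namespace Summit.RiemannHypothesis.RiemannHypothesis.Theorems.PfPersistenceCoefficientRigidity

open Literature.NumberTheory.LFunctions
open Literature.NumberTheory.LFunctions.WeilConverse
open Summit.RiemannHypothesis.RiemannHypothesis.Theorems.PfPersistenceDownCone
open Summit.RiemannHypothesis.RiemannHypothesis.Theorems.PfPersistenceBarrier

/-! ## §31 The `L²` mass of a wave packet -/

/-- `‖g_{R,t₀}‖₂² = I_R(0)`. [this work] -/
theorem integral_norm_sq_wavePacket (R t₀ : ℝ) :
    ∫ u, ‖wavePacket R t₀ u‖ ^ 2 = overlap R 0 := by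
  have h := re_weilConv_wavePacket_overlap R t₀ 0
  rwa [weilConv_weilReflect_apply_zero, Complex.ofReal_re, mul_zero, Real.cos_zero, one_mul] at h

/-! ## §32 The upper construction: `q_λ(g) ≤ -2|λ| + ε` -/

/-- A carrier phase with `λ cos(θ₀ x₀) = -|λ|`: `θ₀ = π/x₀` for `λ ≥ 0`, `2π/x₀` for `λ < 0`.
[this work] -/
theorem exists_mul_cos_eq_neg_abs {x₀ : ℝ} (hx0 : x₀ ≠ 0) (lam : ℝ) :
    ∃ θ₀ : ℝ, lam * Real.cos (θ₀ * x₀) = -|lam| := by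
  rcases le_or_gt 0 lam with h | h
  · refine ⟨π / x₀, ?_⟩
    rw [div_mul_cancel₀ _ hx0, Real.cos_pi, abs_of_nonneg h]
    ring
  · refine ⟨2 * π / x₀, ?_⟩
    rw [div_mul_cancel₀ _ hx0, Real.cos_two_pi, abs_of_neg h]
    ring

/-- **RH branch of the upper construction.**  Under RH, for `x₀ > 0`, any `λ` and `ε > 0` there
is a test function (a wave packet) with `‖g‖₂² > 0` and
`Re W_{λ,x₀}(g ⋆ g̃) ≤ (-2|λ| + ε) ‖g‖₂²`. [this work] -/
theorem exists_siteQuadratic_re_le_ratio_of_riemannHypothesis (hRH : RiemannHypothesis)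
    {x₀ : ℝ} (hx0 : 0 < x₀) (lam : ℝ) {ε : ℝ} (hε : 0 < ε) :
    ∃ g : ℝ → ℂ, IsWeilTest g ∧ 0 < ∫ u, ‖g u‖ ^ 2 ∧
      (siteQuadratic lam x₀ g).re ≤ (-(2 * |lam|) + ε) * ∫ u, ‖g u‖ ^ 2 := by
  obtain ⟨θ₀, hθ₀⟩ := exists_mul_cos_eq_neg_abs hx0.ne' lam
  -- a carrier interval around `θ₀` where `λ cos(t x₀) ≤ -|λ| + ε/4`, and a carrier off the ordinates
  have hcont : Continuous fun t : ℝ ↦ lam * Real.cos (t * x₀) := by fun_prop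
  obtain ⟨η, hη, hball⟩ := Metric.continuous_iff.1 hcont θ₀ (ε / 4) (by positivity)
  have hab : θ₀ - η / 2 < θ₀ + η / 2 := by linarith
  obtain ⟨t₀, ht₀, d, hd, hsep⟩ := exists_far_from_ordinates hab
  have hcos : lam * Real.cos (t₀ * x₀) ≤ -|lam| + ε / 4 := by
    have hdist : dist t₀ θ₀ < η := by
      rw [mem_Icc] at ht₀
      rw [Real.dist_eq, abs_lt]
      constructor <;> linarith
    have h := hball t₀ hdist
    rw [Real.dist_eq, abs_lt] at h
    linarith [h.2]
  -- constants and the dilation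
  obtain ⟨K, hK⟩ := exists_plateau_lipschitz
  have hK0 : (0 : ℝ) ≤ K := K.2
  set S := ∑' ρ : ZetaZeros.riemannZetaNontrivialZeros, weilZeroWeight (ρ : ℂ) with hSdef
  set M := (weilDecayConst plateauC * ((1 + 2 * t₀ ^ 2) * (2 + 1 / d ^ 2))) ^ 2 with hMdef
  have hS : 0 ≤ S := tsum_nonneg fun ρ ↦ weilZeroWeight_nonneg ρ.2
  have hM : 0 ≤ M := sq_nonneg _
  have hMS : 0 ≤ M * S := mul_nonneg hM hS
  set R := max (max 1 (2 * x₀)) ((4 * (M * S) + 16 * K * |lam| * x₀ + 1) / ε) with hRdef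
  have hR1 : 1 ≤ R := (le_max_left _ _).trans (le_max_left _ _)
  have hR0 : 0 < R := by linarith
  have hRε : 4 * (M * S) + 16 * K * |lam| * x₀ + 1 ≤ ε * R := by
    have h := le_max_right (max 1 (2 * x₀)) ((4 * (M * S) + 16 * K * |lam| * x₀ + 1) / ε)
    rw [← hRdef, div_le_iff₀ hε] at h
    linarith
  have hg := isWeilTest_wavePacket hR0 t₀
  have hO0 : R ≤ overlap R 0 := le_overlap_zero hR0
  refine ⟨wavePacket R t₀, hg, ?_, ?_⟩
  · rw [integral_norm_sq_wavePacket]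
    linarith
  rw [integral_norm_sq_wavePacket, siteQuadratic_re,
    ← combShapeDetection_zeroForm_eq_weilQuadratic hg, re_weilConv_wavePacket_overlap]
  have hZ : (zeroForm (wavePacket R t₀)).re ≤ M / R ^ 2 * S :=
    re_zeroForm_wavePacket_le hRH hR0 hd hsep
  have hZ' : M / R ^ 2 * S ≤ M * S :=
    mul_le_mul_of_nonneg_right (div_le_self hM (by nlinarith)) hS
  -- the site term: `2λ cos(t₀x₀) I_R(x₀) = 2λcos · I_R(0) + 2λcos · (I_R(x₀) - I_R(0))`
  have hΔ : |overlap R x₀ - overlap R 0| ≤ 2 * (K : ℝ) * x₀ := by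
    have h := abs_overlap_sub_overlap_zero_le hR0 hK x₀
    rwa [abs_of_pos hx0] at h
  have hlamcos : |lam * Real.cos (t₀ * x₀)| ≤ |lam| := by
    rw [abs_mul]
    exact mul_le_of_le_one_right (abs_nonneg _) (Real.abs_cos_le_one _)
  have herr : lam * Real.cos (t₀ * x₀) * (overlap R x₀ - overlap R 0) ≤ |lam| * (2 * K * x₀) :=
    calc lam * Real.cos (t₀ * x₀) * (overlap R x₀ - overlap R 0)
        ≤ |lam * Real.cos (t₀ * x₀) * (overlap R x₀ - overlap R 0)| := le_abs_self _
      _ = |lam * Real.cos (t₀ * x₀)| * |overlap R x₀ - overlap R 0| := abs_mul _ _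
      _ ≤ |lam| * (2 * K * x₀) := mul_le_mul hlamcos hΔ (abs_nonneg _) (abs_nonneg _)
  have hmain : lam * Real.cos (t₀ * x₀) * overlap R 0 ≤ (-|lam| + ε / 4) * overlap R 0 :=
    mul_le_mul_of_nonneg_right hcos (by linarith)
  have e : 2 * lam * (Real.cos (t₀ * x₀) * overlap R x₀) =
      2 * (lam * Real.cos (t₀ * x₀) * overlap R 0) +
        2 * (lam * Real.cos (t₀ * x₀) * (overlap R x₀ - overlap R 0)) := by ring
  rw [e]
  -- bookkeeping: `M S + 4K|λ|x₀ ≤ (ε/4) R ≤ (ε/4) I_R(0)`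
  have h1 : M * S + 4 * K * |lam| * x₀ ≤ ε / 4 * overlap R 0 := by
    have : ε / 4 * R ≤ ε / 4 * overlap R 0 := mul_le_mul_of_nonneg_left hO0 (by positivity)
    linarith
  nlinarith [hO0, abs_nonneg lam]

/-- **Upper construction (RH-free).**  For `x₀ > 0`, any real `λ` and `ε > 0` some test function
with `‖g‖₂ > 0` has `Re W_{λ,x₀}(g ⋆ g̃) ≤ (-2|λ| + ε)‖g‖₂²` (RH: wave packets; `¬RH`: the
sinking ground energy of part I does better than any constant). [this work] -/
theorem exists_siteQuadratic_re_le_ratio {x₀ : ℝ} (hx0 : 0 < x₀) (lam : ℝ) {ε : ℝ}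
    (hε : 0 < ε) :
    ∃ g : ℝ → ℂ, IsWeilTest g ∧ 0 < ∫ u, ‖g u‖ ^ 2 ∧
      (siteQuadratic lam x₀ g).re ≤ (-(2 * |lam|) + ε) * ∫ u, ‖g u‖ ^ 2 := by
  by_cases hRH : RiemannHypothesis
  · exact exists_siteQuadratic_re_le_ratio_of_riemannHypothesis hRH hx0 lam hε
  · obtain ⟨a, -, -, g, hg, -, hnorm, hW⟩ :=
      exists_weilQuadratic_lt_of_not_riemannHypothesis hRH (4 * |lam|) 0
    refine ⟨g, hg, by rw [hnorm]; exact one_pos, ?_⟩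
    have h := siteQuadratic_re_le lam x₀ hg
    rw [hnorm] at h ⊢
    linarith [abs_nonneg lam]

/-! ## §33 The lower bound under RH and the sharpness of `2` -/

/-- Under RH, `Re W_{λ,x₀}(g ⋆ g̃) ≥ -2|λ| ‖g‖₂²` (`W(g ⋆ g̃) ≥ 0` by Weil's criterion, imported;
`|(g ⋆ g̃)(x₀)| ≤ ‖g‖₂²`). [this work] -/
theorem siteQuadratic_re_ge_of_riemannHypothesis (hRH : RiemannHypothesis) (lam x₀ : ℝ)
    {g : ℝ → ℂ} (hg : IsWeilTest g) :
    -(2 * |lam|) * ∫ u, ‖g u‖ ^ 2 ≤ (siteQuadratic lam x₀ g).re := by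
  have hW : 0 ≤ (weilQuadratic g).re := by
    rw [← siteQuadratic_zero x₀ g]
    exact (siteQuadratic_zero_nonneg_iff_riemannHypothesis x₀).2 hRH g hg
  have h := siteQuadratic_re_le (-lam) x₀ hg
  rw [siteQuadratic_re, abs_neg] at h
  rw [siteQuadratic_re]
  linarith

/-- **Sharpness (RH-free).**  If `B ‖g‖₂² ≤ Re W_{λ,x₀}(g ⋆ g̃)` for every test function with
`‖g‖₂ > 0`, then `B ≤ -2|λ|`. [this work] -/
theorem le_of_siteQuadratic_lower_bound {x₀ : ℝ} (hx0 : 0 < x₀) {lam B : ℝ}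
    (hB : ∀ g : ℝ → ℂ, IsWeilTest g → 0 < ∫ u, ‖g u‖ ^ 2 →
      B * ∫ u, ‖g u‖ ^ 2 ≤ (siteQuadratic lam x₀ g).re) :
    B ≤ -(2 * |lam|) := by
  by_contra h
  push Not at h
  obtain ⟨g, hg, hm, hq⟩ := exists_siteQuadratic_re_le_ratio hx0 lam
    (by linarith : 0 < (B + 2 * |lam|) / 2)
  have h1 := hB g hg hm
  nlinarith

/-! ## §34 The dichotomy: defect energy density `-2|λ|` (RH) versus `-∞` (`¬RH`) -/

/-- **Dichotomy.**  For `x₀ > 0` and any real `λ`: RH holds iff the one-site-perturbed form is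
bounded below relative to `‖g‖₂²` on the test class.  (For `λ = 0` this is Weil's criterion,
imported; RH is NOT claimed.) [this work] -/
theorem riemannHypothesis_iff_siteQuadratic_bddBelow {x₀ : ℝ} (hx0 : 0 < x₀) (lam : ℝ) :
    RiemannHypothesis ↔
      ∃ B : ℝ, ∀ g : ℝ → ℂ, IsWeilTest g → B * ∫ u, ‖g u‖ ^ 2 ≤ (siteQuadratic lam x₀ g).re := by
  constructor
  · exact fun hRH ↦ ⟨-(2 * |lam|), fun g hg ↦ siteQuadratic_re_ge_of_riemannHypothesis hRH lam x₀ hg⟩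
  · rintro ⟨B, hB⟩
    by_contra hRH
    obtain ⟨a, -, -, g, hg, -, hnorm, hW⟩ :=
      exists_weilQuadratic_lt_of_not_riemannHypothesis hRH (|B| + 2 * |lam|) 0
    have h1 := hB g hg
    have h2 := siteQuadratic_re_le lam x₀ hg
    rw [hnorm] at h1 h2
    have _ := hx0
    linarith [neg_abs_le B]

/-- The set of defect energy densities `q_λ(g) = Re W_{λ,x₀}(g ⋆ g̃)/‖g‖₂²` over test functions
with `‖g‖₂ > 0`. [this work] -/
def defectEnergySet (lam x₀ : ℝ) : Set ℝ :=
  {q | ∃ g : ℝ → ℂ, IsWeilTest g ∧ 0 < ∫ u, ‖g u‖ ^ 2 ∧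
    q = (siteQuadratic lam x₀ g).re / ∫ u, ‖g u‖ ^ 2}

/-- **Under RH the defect energy density is exactly `-2|λ|`**: `-2|λ|` is the greatest lower
bound of `{q_λ(g)}`. [this work] -/
theorem isGLB_defectEnergySet_of_riemannHypothesis (hRH : RiemannHypothesis) {x₀ : ℝ}
    (hx0 : 0 < x₀) (lam : ℝ) : IsGLB (defectEnergySet lam x₀) (-(2 * |lam|)) := by
  constructor
  · rintro q ⟨g, hg, hm, rfl⟩
    rw [le_div_iff₀ hm]
    exact siteQuadratic_re_ge_of_riemannHypothesis hRH lam x₀ hg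
  · intro b hb
    refine le_of_siteQuadratic_lower_bound hx0 fun g hg hm ↦ ?_
    have h := hb ⟨g, hg, hm, rfl⟩
    rwa [le_div_iff₀ hm] at h

/-- **Under `¬RH` the defect energy density is `-∞`**: the set `{q_λ(g)}` is not bounded below.
[this work] -/
theorem not_bddBelow_defectEnergySet_of_not_riemannHypothesis (hRH : ¬ RiemannHypothesis)
    (x₀ lam : ℝ) : ¬ BddBelow (defectEnergySet lam x₀) := by
  rintro ⟨B, hB⟩
  obtain ⟨a, -, -, g, hg, -, hnorm, hW⟩ :=
    exists_weilQuadratic_lt_of_not_riemannHypothesis hRH (|B| + 2 * |lam|) 0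
  have hm : 0 < ∫ u, ‖g u‖ ^ 2 := by
    rw [hnorm]
    exact one_pos
  have h1 := hB ⟨g, hg, hm, rfl⟩
  have h2 := siteQuadratic_re_le lam x₀ hg
  rw [hnorm, div_one] at h1
  rw [hnorm] at h2
  linarith [neg_abs_le B]

/-- **Dichotomy, set form (RH-free statement).**  `RH ↔ BddBelow {q_λ(g)}`; together with the two
preceding theorems: the defect energy density of `W + λ(δ_{x₀} + δ_{-x₀})` is `-2|λ|` if RH holds
and `-∞` if it fails. [this work] -/
theorem riemannHypothesis_iff_bddBelow_defectEnergySet {x₀ : ℝ} (hx0 : 0 < x₀) (lam : ℝ) :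
    RiemannHypothesis ↔ BddBelow (defectEnergySet lam x₀) := by
  constructor
  · exact fun hRH ↦ ⟨_, (isGLB_defectEnergySet_of_riemannHypothesis hRH hx0 lam).1⟩
  · intro h
    by_contra hRH
    exact not_bddBelow_defectEnergySet_of_not_riemannHypothesis hRH x₀ lam h

end Summit.RiemannHypothesis.RiemannHypothesis.Theorems.PfPersistenceCoefficientRigidity

end
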